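import Summits.CriticalPhenomena.PercolationContinuityZ3.Theorems.PercNearOneGluingNoHeavyLowerTailKnQuestion8CoefficientwiseAttachmentFlipWeak
import Summits.CriticalPhenomena.PercolationContinuityZ3.Theorems.PercNearOneGluingNoHeavyLowerTailKnQuestion8CoefficientwiseGluing
import HarnessLib

/-!
# Attachment flips are exact symmetries of the POINT ROW: every attachment orbit separating `w` from `u` sums to zero

Support file (`--supports stmt-CriticalPhenomena-4575`, closed), prover `prim-lf-2` (gen 35).  No definitions, no named facts, no sorries; standard axioms.
Memo `prim-lf-2/CW-INVOLUTION-gen35.md` §1–2.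

Setting (prim-lf-2's `Coefficientwise` files): finite multigraph `ends : ι → Sym2 V`, edge set `E`, root `x`, wall vertex `z`, colouring `s ⊆ E` (red) /
`E \ s` (blue), `K s = C_x(s)`, zone `U = K s ∪ K (E \ s)`, `σ_v(s) = 1[v ∈ K s] − 1[v ∈ K (E \ s)]`; the POINT ROW of CW-PA is
`0 ≤ Σ_{s : z ∉ U} σ_u(s) σ_w(s)` (CW-POINTS-gen32).  For a vertex set `W` let `I` be the edges of `E` meeting `W`; `W` is ATTACHED for `s` if every zone
vertex `v' ∉ W ∪ {x}` joined to `W` by an edge lies in `C_x(s \ I) ∩ C_x((E \ s) \ I)` (hypothesis of …CoefficientwiseAttachmentFlipWeak).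
* `Coefficientwise.pointRow_sum_attachOrbit_eq_zero` — for every `W` with `w ∈ W`, `u, x ∉ W`:  `Σ_{s ⊆ E : wall, W attached for s} σ_u(s) σ_w(s) = 0`
  (`s ↦ s ∆ I` is an involution of the index set — the wall and attachment are preserved by the flip formulas and `(s ∆ I) \ I = s \ I` — fixing `σ_u`
  and negating `σ_w`; `Finset.sum_involution`).
* `Coefficientwise.pointRow_sum_eq_sum_not_attached` — hence the point-row sum equals the same sum restricted to the colourings for which `W` is NOT
  attached: attached colourings may be discarded, for any fixed `W ∋ w` avoiding `u, x`.
Consequence (memo §2): with the canonical choice `W = A*(s)` (the minimal attached set containing the lobe of `w`; attached supersets of a lobe are closed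
under intersection, and `A*` is invariant under its own flip, memo §1.2) the point row is carried entirely by the 'entangled' colourings in which no
attached `W` separates `w` from `u` (15 % of the crossing colourings at 6 vertices, 22 % at 7).
[cite: KozmaNitzan2024, Questions 8–9 (§5.5 p. 36) (context: the Question-8 pocket covariance programme)]
-/

namespace Summit.CriticalPhenomena.PercolationContinuityZ3.Theorems

open Finset Literature.Probability.Percolation
open scoped symmDiff

namespace Coefficientwise

variable {ι V : Type*}

open Classical in
/-- **Attachment orbits of the point row sum to zero.**  For every vertex set `W` with `w ∈ W` and `u, x ∉ W`, the sum of `σ_u σ_w` over the wall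
colourings `s ⊆ E` for which `W` is attached vanishes: `s ↦ s ∆ I(W)` is an involution of that set of colourings fixing `σ_u` and negating `σ_w`.
[cite: KozmaNitzan2024, §5.5 (context only)] -/
theorem pointRow_sum_attachOrbit_eq_zero (ends : ι → Sym2 V) (E : Finset ι) (x z u w : V) (W : Set V)
    (hxW : x ∉ W) (huW : u ∉ W) (hwW : w ∈ W) :
    ∑ s ∈ E.powerset.filter (fun s : Finset ι =>
        (z ∉ openCluster (ends '' (↑s : Set ι)) x ∧ z ∉ openCluster (ends '' (↑(E \ s) : Set ι)) x) ∧
        (∀ v ∈ W, ∀ i ∈ E, ∀ v', ends i = s(v, v') →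
          (v' ∈ openCluster (ends '' (↑s : Set ι)) x ∨ v' ∈ openCluster (ends '' (↑(E \ s) : Set ι)) x) → v' ≠ x → v' ∉ W →
            v' ∈ openCluster (ends '' (↑(s \ E.filter (fun i => ∃ v, v ∈ W ∧ v ∈ ends i)) : Set ι)) x ∧
            v' ∈ openCluster (ends '' (↑((E \ s) \ E.filter (fun i => ∃ v, v ∈ W ∧ v ∈ ends i)) : Set ι)) x)),
      ((if u ∈ openCluster (ends '' (↑s : Set ι)) x then (1 : ℝ) else 0) - (if u ∈ openCluster (ends '' (↑(E \ s) : Set ι)) x then (1 : ℝ) else 0)) *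
        ((if w ∈ openCluster (ends '' (↑s : Set ι)) x then (1 : ℝ) else 0) - (if w ∈ openCluster (ends '' (↑(E \ s) : Set ι)) x then (1 : ℝ) else 0))
      = 0 := by
  set I : Finset ι := E.filter (fun i => ∃ v, v ∈ W ∧ v ∈ ends i) with hI
  have hIE : I ⊆ E := Finset.filter_subset _ _
  have memI : ∀ {i : ι}, i ∈ I ↔ i ∈ E ∧ ∃ v, v ∈ W ∧ v ∈ ends i := fun {i} => by rw [hI, Finset.mem_filter]
  have hwx : w ≠ x := fun h => hxW (h ▸ hwW)
  have sdI : ∀ s : Finset ι, (s ∆ I) \ I = s \ I := by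
    intro s; ext i
    simp only [Finset.mem_sdiff, Finset.mem_symmDiff]
    constructor
    · rintro ⟨h | h, hi⟩
      · exact ⟨h.1, hi⟩
      · exact absurd h.1 hi
    · rintro ⟨h, hi⟩
      exact ⟨Or.inl ⟨h, hi⟩, hi⟩
  have csdI : ∀ s : Finset ι, (E \ (s ∆ I)) \ I = (E \ s) \ I := by
    intro s; ext i
    simp only [Finset.mem_sdiff, Finset.mem_symmDiff, not_or, not_and, not_not]
    constructor
    · rintro ⟨⟨hE, h1, -⟩, hi⟩
      exact ⟨⟨hE, fun hs => hi (h1 hs)⟩, hi⟩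
    · rintro ⟨⟨hE, hs⟩, hi⟩
      exact ⟨⟨hE, fun h => absurd h hs, fun h => absurd h hi⟩, hi⟩
  refine Finset.sum_involution (fun s _ => s ∆ I) ?_ ?_ ?_ ?_
  · intro s hs
    rw [Finset.mem_filter, Finset.mem_powerset] at hs
    obtain ⟨hsE, hwall, hWa⟩ := hs
    have red := mem_openCluster_flip_iff_attachment ends (E₀ := E) (s := s) (z := x) hsE W hxW hWa
    have blue := mem_openCluster_sdiff_flip_iff_attachment ends (E₀ := E) (s := s) (z := x) hsE W hxW hWa
    have hu1 : (if u ∈ openCluster (ends '' (↑(s ∆ I) : Set ι)) x then (1 : ℝ) else 0) =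
        (if u ∈ openCluster (ends '' (↑s : Set ι)) x then (1 : ℝ) else 0) := by
      by_cases h : u ∈ openCluster (ends '' (↑s : Set ι)) x
      · rw [if_pos h, if_pos ((red u).mpr (Or.inr (Or.inl ⟨h, huW⟩)))]
      · have h' : u ∉ openCluster (ends '' (↑(s ∆ I) : Set ι)) x := by
          intro hh
          rcases (red u).mp hh with rfl | ⟨hA, -⟩ | ⟨hW, -⟩
          · exact h (mem_openCluster_self _ _)
          · exact h hA
          · exact huW hW
        rw [if_neg h, if_neg h']
    have hu2 : (if u ∈ openCluster (ends '' (↑(E \ (s ∆ I)) : Set ι)) x then (1 : ℝ) else 0) =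
        (if u ∈ openCluster (ends '' (↑(E \ s) : Set ι)) x then (1 : ℝ) else 0) := by
      by_cases h : u ∈ openCluster (ends '' (↑(E \ s) : Set ι)) x
      · rw [if_pos h, if_pos ((blue u).mpr (Or.inr (Or.inl ⟨h, huW⟩)))]
      · have h' : u ∉ openCluster (ends '' (↑(E \ (s ∆ I)) : Set ι)) x := by
          intro hh
          rcases (blue u).mp hh with rfl | ⟨hB, -⟩ | ⟨hW, -⟩
          · exact h (mem_openCluster_self _ _)
          · exact h hB
          · exact huW hW
        rw [if_neg h, if_neg h']
    have hw1 : (if w ∈ openCluster (ends '' (↑(s ∆ I) : Set ι)) x then (1 : ℝ) else 0) =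
        (if w ∈ openCluster (ends '' (↑(E \ s) : Set ι)) x then (1 : ℝ) else 0) := by
      by_cases h : w ∈ openCluster (ends '' (↑(E \ s) : Set ι)) x
      · rw [if_pos h, if_pos ((red w).mpr (Or.inr (Or.inr ⟨hwW, h⟩)))]
      · have h' : w ∉ openCluster (ends '' (↑(s ∆ I) : Set ι)) x := by
          intro hh
          rcases (red w).mp hh with hwx' | ⟨-, hW⟩ | ⟨-, hB⟩
          · exact hwx hwx'
          · exact hW hwW
          · exact h hB
        rw [if_neg h, if_neg h']
    have hw2 : (if w ∈ openCluster (ends '' (↑(E \ (s ∆ I)) : Set ι)) x then (1 : ℝ) else 0) =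
        (if w ∈ openCluster (ends '' (↑s : Set ι)) x then (1 : ℝ) else 0) := by
      by_cases h : w ∈ openCluster (ends '' (↑s : Set ι)) x
      · rw [if_pos h, if_pos ((blue w).mpr (Or.inr (Or.inr ⟨hwW, h⟩)))]
      · have h' : w ∉ openCluster (ends '' (↑(E \ (s ∆ I)) : Set ι)) x := by
          intro hh
          rcases (blue w).mp hh with hwx' | ⟨-, hW⟩ | ⟨-, hA⟩
          · exact hwx hwx'
          · exact hW hwW
          · exact h hA
        rw [if_neg h, if_neg h']
    rw [hu1, hu2, hw1, hw2]
    ring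
  · intro s hs hf heq
    rw [Finset.mem_filter, Finset.mem_powerset] at hs
    obtain ⟨hsE, -, -⟩ := hs
    have hI0 : I = ∅ := by
      have h := symmDiff_eq_left.mp heq
      simpa using h
    have noI : ∀ i ∈ E, w ∉ ends i := by
      intro i hi hwi
      have : i ∈ I := memI.mpr ⟨hi, w, hwW, hwi⟩
      rw [hI0] at this
      exact absurd this (Finset.notMem_empty i)
    have hw1 : w ∉ openCluster (ends '' (↑s : Set ι)) x := by
      intro hw
      obtain ⟨e, he, hwe⟩ := exists_edge_of_mem_openCluster ends hw hwx
      exact noI e (hsE he) hwe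
    have hw2 : w ∉ openCluster (ends '' (↑(E \ s) : Set ι)) x := by
      intro hw
      obtain ⟨e, he, hwe⟩ := exists_edge_of_mem_openCluster ends hw hwx
      exact noI e (Finset.sdiff_subset he) hwe
    apply hf
    rw [if_neg hw1, if_neg hw2, sub_zero, mul_zero]
  · intro s hs
    rw [Finset.mem_filter, Finset.mem_powerset] at hs
    obtain ⟨hsE, hwall, hWa⟩ := hs
    have red := mem_openCluster_flip_iff_attachment ends (E₀ := E) (s := s) (z := x) hsE W hxW hWa
    have blue := mem_openCluster_sdiff_flip_iff_attachment ends (E₀ := E) (s := s) (z := x) hsE W hxW hWa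
    rw [Finset.mem_filter, Finset.mem_powerset]
    refine ⟨?_, ⟨?_, ?_⟩, ?_⟩
    · intro i hi
      rcases Finset.mem_symmDiff.mp hi with ⟨h, -⟩ | ⟨h, -⟩
      · exact hsE h
      · exact hIE h
    · intro hz
      rcases (red z).mp hz with rfl | ⟨hA, -⟩ | ⟨-, hB⟩
      · exact hwall.1 (mem_openCluster_self _ _)
      · exact hwall.1 hA
      · exact hwall.2 hB
    · intro hz
      rcases (blue z).mp hz with rfl | ⟨hB, -⟩ | ⟨-, hA⟩
      · exact hwall.1 (mem_openCluster_self _ _)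
      · exact hwall.2 hB
      · exact hwall.1 hA
    · intro v hv i hi v' he hU hne hnW
      have hU' : v' ∈ openCluster (ends '' (↑s : Set ι)) x ∨ v' ∈ openCluster (ends '' (↑(E \ s) : Set ι)) x := by
        rcases hU with h | h
        · rcases (red v').mp h with h' | ⟨hA, -⟩ | ⟨hW, -⟩
          · exact absurd h' hne
          · exact Or.inl hA
          · exact absurd hW hnW
        · rcases (blue v').mp h with h' | ⟨hB, -⟩ | ⟨hW, -⟩
          · exact absurd h' hne
          · exact Or.inr hB
          · exact absurd hW hnW
      have h := hWa v hv i hi v' he hU' hne hnW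
      rw [sdI s, csdI s]
      exact h
  · intro s hs
    exact symmDiff_symmDiff_cancel_right I s

open Classical in
/-- **Attached colourings may be discarded from the point row.**  For every `W ∋ w` avoiding `u, x`, the point-row sum over all wall colourings equals
the sum over the wall colourings for which `W` is NOT attached. [cite: KozmaNitzan2024, §5.5 (context only)] -/
theorem pointRow_sum_eq_sum_not_attached (ends : ι → Sym2 V) (E : Finset ι) (x z u w : V) (W : Set V)
    (hxW : x ∉ W) (huW : u ∉ W) (hwW : w ∈ W) :
    ∑ s ∈ E.powerset.filter (fun s : Finset ι =>
        z ∉ openCluster (ends '' (↑s : Set ι)) x ∧ z ∉ openCluster (ends '' (↑(E \ s) : Set ι)) x),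
      ((if u ∈ openCluster (ends '' (↑s : Set ι)) x then (1 : ℝ) else 0) - (if u ∈ openCluster (ends '' (↑(E \ s) : Set ι)) x then (1 : ℝ) else 0)) *
        ((if w ∈ openCluster (ends '' (↑s : Set ι)) x then (1 : ℝ) else 0) - (if w ∈ openCluster (ends '' (↑(E \ s) : Set ι)) x then (1 : ℝ) else 0))
    = ∑ s ∈ E.powerset.filter (fun s : Finset ι =>
        (z ∉ openCluster (ends '' (↑s : Set ι)) x ∧ z ∉ openCluster (ends '' (↑(E \ s) : Set ι)) x) ∧
        ¬ (∀ v ∈ W, ∀ i ∈ E, ∀ v', ends i = s(v, v') →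
          (v' ∈ openCluster (ends '' (↑s : Set ι)) x ∨ v' ∈ openCluster (ends '' (↑(E \ s) : Set ι)) x) → v' ≠ x → v' ∉ W →
            v' ∈ openCluster (ends '' (↑(s \ E.filter (fun i => ∃ v, v ∈ W ∧ v ∈ ends i)) : Set ι)) x ∧
            v' ∈ openCluster (ends '' (↑((E \ s) \ E.filter (fun i => ∃ v, v ∈ W ∧ v ∈ ends i)) : Set ι)) x)),
      ((if u ∈ openCluster (ends '' (↑s : Set ι)) x then (1 : ℝ) else 0) - (if u ∈ openCluster (ends '' (↑(E \ s) : Set ι)) x then (1 : ℝ) else 0)) *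
        ((if w ∈ openCluster (ends '' (↑s : Set ι)) x then (1 : ℝ) else 0) - (if w ∈ openCluster (ends '' (↑(E \ s) : Set ι)) x then (1 : ℝ) else 0)) := by
  have h0 := pointRow_sum_attachOrbit_eq_zero ends E x z u w W hxW huW hwW
  set S₀ : Finset (Finset ι) := E.powerset.filter (fun s : Finset ι =>
      z ∉ openCluster (ends '' (↑s : Set ι)) x ∧ z ∉ openCluster (ends '' (↑(E \ s) : Set ι)) x) with hS₀
  set P : Finset ι → Prop := fun s : Finset ι => ∀ v ∈ W, ∀ i ∈ E, ∀ v', ends i = s(v, v') →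
      (v' ∈ openCluster (ends '' (↑s : Set ι)) x ∨ v' ∈ openCluster (ends '' (↑(E \ s) : Set ι)) x) → v' ≠ x → v' ∉ W →
        v' ∈ openCluster (ends '' (↑(s \ E.filter (fun i => ∃ v, v ∈ W ∧ v ∈ ends i)) : Set ι)) x ∧
        v' ∈ openCluster (ends '' (↑((E \ s) \ E.filter (fun i => ∃ v, v ∈ W ∧ v ∈ ends i)) : Set ι)) x with hP
  set f : Finset ι → ℝ := fun s : Finset ι =>
      ((if u ∈ openCluster (ends '' (↑s : Set ι)) x then (1 : ℝ) else 0) - (if u ∈ openCluster (ends '' (↑(E \ s) : Set ι)) x then (1 : ℝ) else 0)) *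
        ((if w ∈ openCluster (ends '' (↑s : Set ι)) x then (1 : ℝ) else 0) - (if w ∈ openCluster (ends '' (↑(E \ s) : Set ι)) x then (1 : ℝ) else 0))
    with hf
  have h1 : ∑ s ∈ S₀, f s = ∑ s ∈ S₀.filter P, f s + ∑ s ∈ S₀.filter (fun s => ¬ P s), f s :=
    (Finset.sum_filter_add_sum_filter_not S₀ P f).symm
  have h2 : S₀.filter P = E.powerset.filter (fun s : Finset ι =>
      (z ∉ openCluster (ends '' (↑s : Set ι)) x ∧ z ∉ openCluster (ends '' (↑(E \ s) : Set ι)) x) ∧ P s) := by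
    rw [hS₀, Finset.filter_filter]
  have h3 : S₀.filter (fun s => ¬ P s) = E.powerset.filter (fun s : Finset ι =>
      (z ∉ openCluster (ends '' (↑s : Set ι)) x ∧ z ∉ openCluster (ends '' (↑(E \ s) : Set ι)) x) ∧ ¬ P s) := by
    rw [hS₀, Finset.filter_filter]
  rw [h1, h2, h3, hP, h0, zero_add]

end Coefficientwise

end Summit.CriticalPhenomena.PercolationContinuityZ3.Theorems
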